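import Mathlib
import Literature.Analysis.Complex.CauchyPompeiu
import Literature.Analysis.Complex.CauchyTransform
import Literature.Analysis.Complex.CauchyTransformSupport
import Literature.Analysis.Complex.DbarAlongCalculus
import Literature.Analysis.Complex.ApproximateHolomorphy
import Literature.Analysis.Complex.SimilarityIntegratingFactor
import Literature.Analysis.Complex.SimilarityVectorCoefficient
import Literature.Analysis.Complex.MontelVector
import HarnessLib

/-!
# The vector-valued similarity principle: zeros of solutions of `‖∂̄w‖ ≤ K ‖w‖`

**Theorem** (Carleman 1939; Bers, Vekua; the "similarity principle", Wendl, *Lectures on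
holomorphic curves*, Thm 2.50 / Prop. 2.54; McDuff–Salamon (2012), §2.3). Let `F` be a
finite-dimensional complex inner product space and `w : ℂ → F` smooth on a disc `B(c, r)` with
`‖∂̄w z‖ ≤ K ‖w z‖` there. Then EITHER `w` vanishes on a neighbourhood of `c`, OR `w ≠ 0` on a
punctured neighbourhood of `c` (a zero at `c` is isolated).

* `Literature.Analysis.Complex.zeroDichotomy_of_norm_dbar_le` — the statement above;
* `Literature.Analysis.Complex.exists_holomorphic_comparison_of_norm_dbar_le` — the underlying
  COMPARISON: on a small disc about `c` there is a holomorphic `H : ℂ → F` with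
  `(2/3) ‖w z‖ ≤ ‖H z‖ ≤ (4/3) ‖w z‖` (so `w` and `H` have the same zeros).

Proof (the tree's `δ`-regularisation route of the scalar file
`Literature/Analysis/Complex/SimilarityPrinciple.lean`, made vector-valued WITHOUT differentiating
the integrating factor). Cut `w` off to a global smooth `w̃`; for `δ > 0` let
`B_δ = χ • regOp w̃ δ` (`SimilarityVectorCoefficient.lean`: smooth, supported in a small disc,
`‖B_δ‖ ≤ K`, and `∂̄w - B_δ w = (δ/(‖w‖²+δ)) ∂̄w` has norm `≤ K √δ / 2` near `c`) and
`Ψ_δ = integratingFactor B_δ` (`SimilarityIntegratingFactor.lean`: continuous,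
`‖x‖ ≤ (3/2) ‖Ψ_δ z x‖`, `‖Ψ_δ z‖ ≤ 4/3`, and `Ψ_δ w̃ = T(Ψ_δ (∂̄w̃ - B_δ w̃))`). Splitting the
density with a second cut-off, `Ψ_δ w̃ = T(χ' g_δ) + T((1-χ') g_δ)` where the first term is
`O(√δ)` in sup norm and the second, `H_δ`, is holomorphic near `c`
(`CauchyTransformSupport.lean`). The `H_δ` are uniformly bounded; by the vector Montel theorem
(`MontelVector.lean`) a subsequence `δ → 0` converges locally uniformly to a holomorphic `H`, and
the two-sided bounds pass to the limit. The zero dichotomy for `w` is then that of the analytic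
`H` (Mathlib's `AnalyticAt.eventually_eq_zero_or_eventually_ne_zero`).

Everything is proved; no named facts. This is the analytic input of unique continuation for
`J`-holomorphic curves (`Literature.Geometry.Symplectic.jHolomorphicFlat_uniqueContinuation_const`).

## References

* C. Wendl, *Lectures on Holomorphic Curves in Symplectic and Contact Geometry*
  (arXiv:1011.1690), Thm 2.50, Prop. 2.54. [WendlLectures2010]
* D. McDuff, D. Salamon, *J-holomorphic curves and symplectic topology*, 2nd ed. (2012), §2.3
  (Carleman similarity principle). [McDuffSalamon2012]
* T. Carleman, *Sur les systèmes linéaires aux dérivées partielles du premier ordre à deux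
  variables*, C. R. Acad. Sci. Paris 197 (1933) 471–474.
-/

noncomputable section

open scoped ContDiff Topology Real
open Set Metric Filter Complex

namespace Literature.Analysis.Complex

namespace SimilarityVector

section Limits

variable {F : Type*} [NormedAddCommGroup F]

/-- Passing two-sided bounds to the limit: if `u k → L`, `‖v k - u k‖ ≤ e k → 0`, and
`lo ≤ ‖v k‖ ≤ hi`, then `lo ≤ ‖L‖ ≤ hi`. [folklore] -/
theorem norm_le_of_tendsto_vec {u v : ℕ → F} {L : F} {e : ℕ → ℝ} {lo hi : ℝ}
    (hu : Tendsto u atTop (𝓝 L)) (he : Tendsto e atTop (𝓝 0))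
    (hclose : ∀ k, ‖v k - u k‖ ≤ e k) (hlo : ∀ k, lo ≤ ‖v k‖) (hhi : ∀ k, ‖v k‖ ≤ hi) :
    lo ≤ ‖L‖ ∧ ‖L‖ ≤ hi := by
  have hn : Tendsto (fun k => ‖u k‖) atTop (𝓝 ‖L‖) := hu.norm
  constructor
  · have h1 : Tendsto (fun k => lo - e k) atTop (𝓝 (lo - 0)) := tendsto_const_nhds.sub he
    rw [sub_zero] at h1
    refine le_of_tendsto_of_tendsto' h1 hn fun k => ?_
    have := norm_sub_norm_le (v k) (u k)
    linarith [hclose k, hlo k]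
  · have h1 : Tendsto (fun k => hi + e k) atTop (𝓝 (hi + 0)) := tendsto_const_nhds.add he
    rw [add_zero] at h1
    refine le_of_tendsto_of_tendsto' hn h1 fun k => ?_
    have := norm_sub_norm_le (u k) (v k)
    have hc : ‖u k - v k‖ ≤ e k := by rw [norm_sub_rev]; exact hclose k
    linarith [hhi k]

end Limits

/-! ### One step of the regularisation: the comparison package for fixed `δ > 0` -/

section Step

variable {F : Type*} [NormedAddCommGroup F] [InnerProductSpace ℂ F] [CompleteSpace F]

omit [CompleteSpace F] in
/-- The cut-off coefficient of `SimilarityVectorCoefficient.lean`, existentially packaged (an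
opaque `B` is cheaper to elaborate with). [folklore] -/
theorem exists_cutoffCoefficient {w : ℂ → F} (hw : ContDiff ℝ ∞ w) {δ K ρ : ℝ} (hδ : 0 < δ)
    (hK : 0 ≤ K) (hineq : ∀ z, ‖z‖ < ρ → ‖dbarAlong 1 w z‖ ≤ K * ‖w z‖)
    {χ : ℂ → ℂ} (hχ : ContDiff ℝ ∞ χ) (hχρ : ∀ z, χ z ≠ 0 → ‖z‖ < ρ) (hχ1 : ∀ z, ‖χ z‖ ≤ 1) :
    ∃ B : ℂ → F →L[ℂ] F, ContDiff ℝ 1 B ∧ (∀ z, B z ≠ 0 → ‖z‖ < ρ) ∧ (∀ z, ‖B z‖ ≤ K) ∧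
      ∀ z, χ z = 1 → ‖dbarAlong 1 w z - B z (w z)‖ ≤ K * Real.sqrt δ / 2 := by
  obtain ⟨h1, h2, h3, h4⟩ := cutoffCoefficient hw hδ hK hineq hχ hχρ hχ1
  exact ⟨fun z => χ z • regOp w δ z, h1.of_le (by exact_mod_cast le_top), h2, h3, h4⟩

/-- The integrating factor of `SimilarityIntegratingFactor.lean` and the density
`g = Ψ ∂̄w - Ψ B w`, existentially packaged with the properties used below. [folklore] -/
theorem exists_integratingFactor_package {B : ℂ → F →L[ℂ] F} {ρ K : ℝ} (hB : ContDiff ℝ 1 B)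
    (hρ : 0 < ρ) (hK : 0 ≤ K) (hsupp : ∀ z, B z ≠ 0 → ‖z‖ < ρ) (hbound : ∀ z, ‖B z‖ ≤ K)
    (hsmall : 16 * ρ * K ≤ 1) {w : ℂ → F} (hw : ContDiff ℝ ∞ w) (hws : HasCompactSupport w) :
    ∃ (Ψ : ℂ → F →L[ℂ] F) (g : ℂ → F), Continuous Ψ ∧
      (∀ z, ‖z‖ ≤ ρ → ‖Ψ z‖ ≤ 4 / 3) ∧
      (∀ z, ‖z‖ ≤ ρ → ∀ x : F, ‖x‖ ≤ 3 / 2 * ‖Ψ z x‖) ∧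
      (∀ ζ, g ζ = Ψ ζ (dbarAlong 1 w ζ - B ζ (w ζ))) ∧
      Continuous g ∧ HasCompactSupport g ∧
      ∀ z, Ψ z (w z) = cauchyTransformAlong 1 g z := by
  have hw1 : ContDiff ℝ 1 w := hw.of_le (by exact_mod_cast le_top)
  have hΨc := continuous_integratingFactor hB hρ hK hsupp hbound hsmall
  refine ⟨integratingFactor B,
    fun ζ => integratingFactor B ζ (dbarAlong 1 w ζ) - integratingFactor B ζ (B ζ (w ζ)), hΨc,
    fun z hz => norm_integratingFactor_le hB hρ hK hsupp hbound hsmall hz,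
    fun z hz x => norm_le_mul_norm_integratingFactor_apply hB hρ hK hsupp hbound hsmall hz x,
    fun ζ => by rw [map_sub], ?_, ?_,
    fun z => integratingFactor_apply_eq_cauchyTransform hB hρ hK hsupp hbound hsmall hw1 hws z⟩
  · have hdw : Continuous (dbarAlong 1 w) := continuous_dbarAlong hw1 1
    refine Continuous.sub ?_ ?_
    · exact (contDiff_clm_apply_real (n := 0) (contDiff_zero.2 hΨc) (contDiff_zero.2 hdw)).continuous
    · exact (contDiff_clm_apply_real (n := 0) (contDiff_zero.2 hΨc) (contDiff_zero.2
        (contDiff_clm_apply_real (n := 0) (contDiff_zero.2 hB.continuous)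
          (contDiff_zero.2 hw.continuous)).continuous)).continuous
  · refine HasCompactSupport.intro hws.isCompact fun ζ hζ => ?_
    have h1 : w ζ = 0 := image_eq_zero_of_notMem_tsupport hζ
    have h2 : dbarAlong 1 w ζ = 0 := by
      have h : fderiv ℝ w ζ = 0 := by
        by_contra h
        exact hζ (support_fderiv_subset ℝ (Function.mem_support.2 h))
      simp only [dbarAlong, h, zero_apply, smul_zero, add_zero]
    simp only [h1, h2, map_zero, sub_zero]

/-- **One regularisation step.** For a global `C^∞` compactly supported `w` with
`‖∂̄w z‖ ≤ K ‖w z‖` on `‖z‖ < ρ`, `16 ρ K ≤ 1`, cut-offs `χ` (`= 1` on `‖z‖ ≤ ρ/2`, supported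
in `‖z‖ < ρ`) and `χ'` (`= 1` on `‖z‖ ≤ ρ/4`, supported in `‖z‖ < ρ/2`), and `δ > 0`: there are
`H` holomorphic on `B(0, ρ/8)` and `v` (namely `v = Ψ_δ w`, `H = T((1-χ') Ψ_δ(∂̄w - B_δ w))`)
with `‖v - H‖ = O(√δ)`, `(2/3)‖w‖ ≤ ‖v‖ ≤ (4/3)‖w‖` on `B(0, ρ/8)` and `H` bounded
independently of small `δ`. [cite: WendlLectures2010, Thm 2.50 (proof)] -/
theorem comparison_step {w : ℂ → F} (hw : ContDiff ℝ ∞ w) (hws : HasCompactSupport w)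
    {K ρ δ W : ℝ} (hK : 0 ≤ K) (hρ : 0 < ρ) (hρK : 16 * ρ * K ≤ 1) (hδ : 0 < δ)
    (hineq : ∀ z, ‖z‖ < ρ → ‖dbarAlong 1 w z‖ ≤ K * ‖w z‖) (hW : ∀ z, ‖w z‖ ≤ W)
    {χ : ℂ → ℂ} (hχ : ContDiff ℝ ∞ χ) (hχ1 : ∀ z, ‖z‖ ≤ ρ / 2 → χ z = 1)
    (hχ0 : ∀ z, χ z ≠ 0 → ‖z‖ < ρ) (hχle : ∀ z, ‖χ z‖ ≤ 1)
    {χ' : ℂ → ℂ} (hχ' : ContDiff ℝ ∞ χ') (hχ'1 : ∀ z, ‖z‖ ≤ ρ / 4 → χ' z = 1)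
    (hχ'0 : ∀ z, χ' z ≠ 0 → ‖z‖ < ρ / 2) (hχ'le : ∀ z, ‖χ' z‖ ≤ 1) :
    ∃ H v : ℂ → F, DifferentiableOn ℂ H (ball 0 (ρ / 8)) ∧
      (∀ z, ‖z‖ < ρ / 8 → ‖H z‖ ≤ 4 / 3 * W + 2 * ρ * (4 / 3 * (K * Real.sqrt δ / 2))) ∧
      (∀ z, ‖z‖ < ρ / 8 → ‖v z - H z‖ ≤ 2 * ρ * (4 / 3 * (K * Real.sqrt δ / 2))) ∧
      (∀ z, ‖z‖ < ρ / 8 → 2 / 3 * ‖w z‖ ≤ ‖v z‖) ∧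
      (∀ z, ‖z‖ < ρ / 8 → ‖v z‖ ≤ 4 / 3 * ‖w z‖) := by
  obtain ⟨B, hB1, hBsupp, hBK, hBdef⟩ := exists_cutoffCoefficient hw hδ hK hineq hχ hχ0 hχle
  obtain ⟨Ψ, g, hΨc, hΨle, hΨlo, hg, hgc, hgs, hrep⟩ :=
    exists_integratingFactor_package hB1 hρ hK hBsupp hBK hρK hw hws
  set Eδ : ℝ := 4 / 3 * (K * Real.sqrt δ / 2) with hEδ
  have hEδ0 : 0 ≤ Eδ := by positivity
  -- the defect bound on `‖ζ‖ < ρ/2` (where `χ = 1`)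
  have hgsmall : ∀ ζ, ‖ζ‖ < ρ / 2 → ‖g ζ‖ ≤ Eδ := by
    intro ζ hζ
    rw [hg ζ]
    calc ‖Ψ ζ (dbarAlong 1 w ζ - B ζ (w ζ))‖ ≤ ‖Ψ ζ‖ * ‖dbarAlong 1 w ζ - B ζ (w ζ)‖ :=
          ContinuousLinearMap.le_opNorm _ _
      _ ≤ 4 / 3 * (K * Real.sqrt δ / 2) := by
          gcongr
          · exact hΨle ζ (by linarith)
          · exact hBdef ζ (hχ1 ζ hζ.le)
  -- the two pieces `g₁ = χ' g` and `g₂ = (1 - χ') g`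
  obtain ⟨g₁, hg₁⟩ : ∃ g₁ : ℂ → F, ∀ ζ, g₁ ζ = χ' ζ • g ζ := ⟨_, fun _ => rfl⟩
  obtain ⟨g₂, hg₂⟩ : ∃ g₂ : ℂ → F, ∀ ζ, g₂ ζ = (1 - χ' ζ) • g ζ := ⟨_, fun _ => rfl⟩
  have hg₁f : g₁ = fun ζ => χ' ζ • g ζ := funext hg₁
  have hg₂f : g₂ = fun ζ => (1 - χ' ζ) • g ζ := funext hg₂
  have hg₁c : Continuous g₁ := by rw [hg₁f]; exact hχ'.continuous.smul hgc
  have hg₂c : Continuous g₂ := by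
    rw [hg₂f]; exact (continuous_const.sub hχ'.continuous).smul hgc
  have hg₁s : HasCompactSupport g₁ := by rw [hg₁f]; exact hgs.smul_left
  have hg₂s : HasCompactSupport g₂ := by rw [hg₂f]; exact hgs.smul_left
  have hgsum : g = g₁ + g₂ := by
    funext ζ
    rw [Pi.add_apply, hg₁, hg₂, sub_smul, one_smul, add_sub_cancel]
  have hsplit : ∀ z, cauchyTransformAlong 1 g z =
      cauchyTransformAlong 1 g₁ z + cauchyTransformAlong 1 g₂ z := by
    intro z
    rw [← cauchyTransformAlong_add hg₁c hg₁s hg₂c hg₂s one_ne_zero, ← hgsum]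
  -- `T g₂` is holomorphic on `‖z‖ < ρ/8` (`g₂ = 0` on `‖z‖ < ρ/4`)
  have hH : DifferentiableOn ℂ (cauchyTransformAlong 1 g₂) (ball 0 (ρ / 8)) := by
    refine differentiableOn_cauchyTransform_of_eq_zero hg₂c hg₂s (ρm := ρ / 4) (by linarith)
      fun z hz => ?_
    rw [hg₂, hχ'1 z (mem_ball_zero_iff.1 hz).le, sub_self, zero_smul]
  -- `T g₁` is small on `‖z‖ ≤ ρ/8`
  have hg₁supp : ∀ ζ, g₁ ζ ≠ 0 → ‖ζ‖ < ρ / 2 := by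
    intro ζ hζ
    refine hχ'0 ζ fun h => hζ ?_
    rw [hg₁, h, zero_smul]
  have hg₁bd : ∀ ζ, ‖g₁ ζ‖ ≤ Eδ := by
    intro ζ
    by_cases hζ : χ' ζ = 0
    · rw [hg₁, hζ, zero_smul, norm_zero]; exact hEδ0
    · rw [hg₁, norm_smul]
      calc ‖χ' ζ‖ * ‖g ζ‖ ≤ 1 * Eδ := by
            gcongr
            · exact hχ'le ζ
            · exact hgsmall ζ (hχ'0 ζ hζ)
        _ = Eδ := one_mul _
  have hsmall : ∀ z, ‖z‖ < ρ / 8 → ‖cauchyTransformAlong 1 g₁ z‖ ≤ 2 * ρ * Eδ := by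
    intro z hz
    have key := norm_cauchyTransform_le_of_norm_le (g := g₁) (ρ := ρ / 2) (ρ' := ρ / 8)
      (by positivity) hEδ0 hg₁supp hg₁bd hz.le
    calc ‖cauchyTransformAlong 1 g₁ z‖ ≤ 2 * (ρ / 8 + ρ / 2) * Eδ := key
      _ ≤ 2 * ρ * Eδ := by gcongr; linarith
  refine ⟨cauchyTransformAlong 1 g₂, fun z => Ψ z (w z), hH, fun z hz => ?_, fun z hz => ?_,
    fun z hz => ?_, fun z hz => ?_⟩
  · -- bound for `H`
    have e : cauchyTransformAlong 1 g₂ z = Ψ z (w z) - cauchyTransformAlong 1 g₁ z := by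
      rw [hrep z, hsplit z]; abel
    rw [e]
    calc ‖Ψ z (w z) - cauchyTransformAlong 1 g₁ z‖
        ≤ ‖Ψ z (w z)‖ + ‖cauchyTransformAlong 1 g₁ z‖ := norm_sub_le _ _
      _ ≤ 4 / 3 * W + 2 * ρ * Eδ := by
        gcongr
        · calc ‖Ψ z (w z)‖ ≤ ‖Ψ z‖ * ‖w z‖ := ContinuousLinearMap.le_opNorm _ _
            _ ≤ 4 / 3 * W := by
              gcongr
              · exact hΨle z (by linarith)
              · exact hW z
        · exact hsmall z hz
  · -- closeness
    have e : Ψ z (w z) - cauchyTransformAlong 1 g₂ z = cauchyTransformAlong 1 g₁ z := by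
      rw [hrep z, hsplit z]; abel
    rw [e]
    exact hsmall z hz
  · -- lower bound
    have h := hΨlo z (by linarith) (w z)
    linarith
  · -- upper bound
    calc ‖Ψ z (w z)‖ ≤ ‖Ψ z‖ * ‖w z‖ := ContinuousLinearMap.le_opNorm _ _
      _ ≤ 4 / 3 * ‖w z‖ := by
        gcongr
        exact hΨle z (by linarith)

end Step

end SimilarityVector

open SimilarityVector Similarity

variable {F : Type*} [NormedAddCommGroup F] [InnerProductSpace ℂ F] [FiniteDimensional ℂ F]

/-- **The holomorphic comparison function (vector-valued similarity principle), centred form.**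
Let `w : ℂ → F` be `C^∞` on `B(0, r)` with `‖∂̄w z‖ ≤ K ‖w z‖` there (`K ≥ 0`). Then for some
`ρ₂ > 0` there is `H` holomorphic on `B(0, ρ₂)` with `(2/3) ‖w z‖ ≤ ‖H z‖ ≤ (4/3) ‖w z‖` on
`B(0, ρ₂)`. [cite: WendlLectures2010, Thm 2.50] -/
theorem exists_holomorphic_comparison_of_norm_dbar_le_zero {w : ℂ → F} {r K : ℝ} (hr : 0 < r)
    (hK : 0 ≤ K) (hw : ContDiffOn ℝ ∞ w (ball 0 r))
    (hineq : ∀ z ∈ ball (0 : ℂ) r, ‖dbarAlong 1 w z‖ ≤ K * ‖w z‖) :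
    ∃ ρ₂ : ℝ, 0 < ρ₂ ∧ ρ₂ < r ∧ ∃ H : ℂ → F, DifferentiableOn ℂ H (ball 0 ρ₂) ∧
      ∀ z ∈ ball (0 : ℂ) ρ₂, 2 / 3 * ‖w z‖ ≤ ‖H z‖ ∧ ‖H z‖ ≤ 4 / 3 * ‖w z‖ := by
  haveI : CompleteSpace F := FiniteDimensional.complete ℂ F
  haveI : ProperSpace F := FiniteDimensional.proper ℂ F
  -- radii: `16 ρ K ≤ 1`, `2ρ < r`
  obtain ⟨ρ, hρ0, hρr, hρK⟩ : ∃ ρ : ℝ, 0 < ρ ∧ 2 * ρ < r ∧ 16 * ρ * K ≤ 1 := by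
    refine ⟨min (r / 4) (1 / (16 * (K + 1))), lt_min (by positivity) (by positivity), ?_, ?_⟩
    · have : min (r / 4) (1 / (16 * (K + 1))) ≤ r / 4 := min_le_left _ _
      linarith
    · have h1 : min (r / 4) (1 / (16 * (K + 1))) ≤ 1 / (16 * (K + 1)) := min_le_right _ _
      have h0 : 0 ≤ min (r / 4) (1 / (16 * (K + 1))) := by positivity
      rw [le_div_iff₀ (by positivity)] at h1
      nlinarith
  -- the global smooth cut-off extension `w̃ = χ₀ • w`
  obtain ⟨χ₀, hχ₀, hχ₀c, hχ₀1, hχ₀0, -⟩ :=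
    exists_cutoff (ρm := ρ) (ρ := 2 * ρ) hρ0 (by linarith)
  have hχ₀t : tsupport χ₀ ⊆ ball (0 : ℂ) r := by
    intro z hz
    have h1 : z ∈ closedBall (0 : ℂ) (2 * ρ) := by
      refine closure_minimal (fun y hy => ?_) isClosed_closedBall hz
      exact mem_closedBall_zero_iff.2 (hχ₀0 y hy).le
    exact closedBall_subset_ball hρr h1
  obtain ⟨wt, hwt⟩ : ∃ wt : ℂ → F, ∀ z, wt z = χ₀ z • w z := ⟨_, fun _ => rfl⟩
  have hwtf : wt = fun z => χ₀ z • w z := funext hwt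
  have hwt_smooth : ContDiff ℝ ∞ wt := by
    rw [hwtf]; exact contDiff_smul_of_tsupport_subset isOpen_ball hχ₀ hχ₀t hw
  have hwt_eq : ∀ z, ‖z‖ ≤ ρ → wt z = w z := fun z hz => by
    rw [hwt, hχ₀1 z hz, one_smul]
  have hwt_ev : ∀ z, ‖z‖ < ρ → wt =ᶠ[𝓝 z] w := fun z hz => by
    filter_upwards [isOpen_ball.mem_nhds (mem_ball_zero_iff.2 hz)] with y hy
    exact hwt_eq y (mem_ball_zero_iff.1 hy).le
  have hwt_ineq : ∀ z, ‖z‖ < ρ → ‖dbarAlong 1 wt z‖ ≤ K * ‖wt z‖ := fun z hz => by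
    rw [dbarAlong_congr_of_eventuallyEq (hwt_ev z hz) 1, hwt_eq z hz.le]
    exact hineq z (mem_ball_zero_iff.2 (by linarith))
  have hwt_supp : HasCompactSupport wt := by rw [hwtf]; exact hχ₀c.smul_right
  -- the cut-offs `χ` (`= 1` on `‖z‖ ≤ ρ/2`, supported in `‖z‖ < ρ`) and `χ'`
  obtain ⟨χ, hχ, -, hχ1, hχ0, hχle⟩ :=
    exists_cutoff (ρm := ρ / 2) (ρ := ρ) (by positivity) (by linarith)
  obtain ⟨χ', hχ', -, hχ'1, hχ'0, hχ'le⟩ :=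
    exists_cutoff (ρm := ρ / 4) (ρ := ρ / 2) (by positivity) (by linarith)
  -- a bound for `w̃`
  obtain ⟨W, -, hW⟩ := exists_bound_of_hasCompactSupport hwt_smooth.continuous hwt_supp
  -- the sequence `δₙ = 1/(n+1)²` and its comparison packages
  have hδn : ∀ n : ℕ, (0 : ℝ) < 1 / ((n : ℝ) + 1) ^ 2 := fun n => by positivity
  choose Hn vn hHn hHnb hvn hvlo hvhi using fun n : ℕ =>
    comparison_step hwt_smooth hwt_supp hK hρ0 hρK (hδn n) hwt_ineq hW hχ hχ1 hχ0 hχle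
      hχ' hχ'1 hχ'0 hχ'le
  have hsqrt : ∀ n : ℕ, Real.sqrt (1 / ((n : ℝ) + 1) ^ 2) = 1 / ((n : ℝ) + 1) := fun n => by
    rw [Real.sqrt_div zero_le_one, Real.sqrt_one, Real.sqrt_sq (by positivity)]
  have hHnb' : ∀ n, ∀ z ∈ ball (0 : ℂ) (ρ / 8),
      ‖Hn n z‖ ≤ 4 / 3 * W + 2 * ρ * (4 / 3 * (K * 1 / 2)) := by
    intro n z hz
    refine (hHnb n z (mem_ball_zero_iff.1 hz)).trans ?_
    rw [hsqrt n]
    have h1 : 1 / ((n : ℝ) + 1) ≤ 1 := by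
      rw [div_le_one (by positivity)]; linarith [n.cast_nonneg (α := ℝ)]
    gcongr
  -- Montel
  obtain ⟨Hlim, φ, hφ, hHlim, hloc, -⟩ :=
    MontelVector.exists_strictMono_tendstoLocallyUniformlyOn_of_norm_le isOpen_ball hHn hHnb'
  -- the errors along the subsequence tend to `0`
  have he : Tendsto (fun k => 2 * ρ * (4 / 3 * (K * (1 / ((φ k : ℝ) + 1)) / 2))) atTop (𝓝 0) := by
    have h1 : Tendsto (fun k => 1 / ((φ k : ℝ) + 1)) atTop (𝓝 0) :=
      (tendsto_one_div_add_atTop_nhds_zero_nat (𝕜 := ℝ)).comp hφ.tendsto_atTop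
    have h2 := (((h1.const_mul K).div_const 2).const_mul (4 / 3)).const_mul (2 * ρ)
    rw [mul_zero, zero_div, mul_zero, mul_zero] at h2
    exact h2
  refine ⟨ρ / 8, by positivity, by linarith, Hlim, hHlim, fun z hz => ?_⟩
  have hz' : ‖z‖ < ρ / 8 := mem_ball_zero_iff.1 hz
  have hwz : wt z = w z := hwt_eq z (by linarith)
  rw [← hwz]
  refine norm_le_of_tendsto_vec (v := fun k => vn (φ k) z) (u := fun k => Hn (φ k) z)
    (hloc.tendsto_at hz) he (fun k => ?_) (fun k => hvlo (φ k) z hz') (fun k => hvhi (φ k) z hz')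
  have h := hvn (φ k) z hz'
  rwa [hsqrt (φ k)] at h

/-- **Vector-valued similarity principle: the zero dichotomy, centred form.** Let `w : ℂ → F` be
`C^∞` on `B(0, r)` with `‖∂̄w z‖ ≤ K ‖w z‖` there. Then either `w = 0` near `0` or `w ≠ 0` on a
punctured neighbourhood of `0` (the interesting case being `w 0 = 0`).
[cite: WendlLectures2010, Thm 2.50] -/
theorem zeroDichotomy_of_norm_dbar_le_zero {w : ℂ → F} {r K : ℝ} (hr : 0 < r)
    (hw : ContDiffOn ℝ ∞ w (ball 0 r))
    (hineq : ∀ z ∈ ball (0 : ℂ) r, ‖dbarAlong 1 w z‖ ≤ K * ‖w z‖) :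
    (∀ᶠ z in 𝓝 (0 : ℂ), w z = 0) ∨ (∀ᶠ z in 𝓝[≠] (0 : ℂ), w z ≠ 0) := by
  haveI : CompleteSpace F := FiniteDimensional.complete ℂ F
  -- `K ≥ 0` without loss of generality
  have hineq' : ∀ z ∈ ball (0 : ℂ) r, ‖dbarAlong 1 w z‖ ≤ max K 0 * ‖w z‖ := fun z hz =>
    (hineq z hz).trans (mul_le_mul_of_nonneg_right (le_max_left _ _) (norm_nonneg _))
  obtain ⟨ρ₂, hρ₂, -, H, hH, hcomp⟩ :=
    exists_holomorphic_comparison_of_norm_dbar_le_zero hr (le_max_right K 0) hw hineq'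
  -- `w` and `H` have the same zeros on `B(0, ρ₂)`
  have hiff : ∀ z ∈ ball (0 : ℂ) ρ₂, w z = 0 ↔ H z = 0 := by
    intro z hz
    obtain ⟨h1, h2⟩ := hcomp z hz
    constructor
    · intro h
      rw [h, norm_zero, mul_zero] at h2
      exact norm_le_zero_iff.1 h2
    · intro h
      rw [h, norm_zero] at h1
      have : ‖w z‖ ≤ 0 := by linarith
      exact norm_le_zero_iff.1 this
  have hHa : AnalyticAt ℂ H 0 :=
    (hH.analyticOnNhd isOpen_ball) 0 (mem_ball_self hρ₂)
  have hball : ∀ᶠ z in 𝓝 (0 : ℂ), z ∈ ball (0 : ℂ) ρ₂ := isOpen_ball.mem_nhds (mem_ball_self hρ₂)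
  rcases hHa.eventually_eq_zero_or_eventually_ne_zero with hz | hnz
  · left
    filter_upwards [hz, hball] with z h1 h2
    exact (hiff z h2).2 h1
  · right
    have hball' : ∀ᶠ z in 𝓝[≠] (0 : ℂ), z ∈ ball (0 : ℂ) ρ₂ := nhdsWithin_le_nhds hball
    filter_upwards [hnz, hball'] with z h1 h2
    exact fun h => h1 ((hiff z h2).1 h)

/-- **Vector-valued similarity principle: the zero dichotomy** (Carleman; Wendl Thm 2.50 /
Prop. 2.54; McDuff–Salamon 2012, §2.3). Let `F` be a finite-dimensional complex inner product
space and `w : ℂ → F` of class `C^∞` on `B(c, r)` with `‖∂̄w z‖ ≤ K ‖w z‖` for `z ∈ B(c, r)`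
(`∂̄ = dbarAlong 1 = ½(∂ₛ + i∂ₜ)`). Then EITHER `w` vanishes on a neighbourhood of `c`, OR
`w z ≠ 0` for all `z ≠ c` near `c` (so a zero at `c` is isolated; the hypothesis `w c = 0` of the
usual formulation is not needed). [cite: WendlLectures2010, Thm 2.50] -/
theorem zeroDichotomy_of_norm_dbar_le {w : ℂ → F} {c : ℂ} {r K : ℝ} (hr : 0 < r)
    (hw : ContDiffOn ℝ ∞ w (ball c r))
    (hineq : ∀ z ∈ ball c r, ‖dbarAlong 1 w z‖ ≤ K * ‖w z‖) :
    (∀ᶠ z in 𝓝 c, w z = 0) ∨ (∀ᶠ z in 𝓝[≠] c, w z ≠ 0) := by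
  -- translate to the origin
  set w' : ℂ → F := fun z => w (z + c) with hw'
  have hw'd : ContDiffOn ℝ ∞ w' (ball 0 r) := by
    intro z hz
    have hz' : z + c ∈ ball c r := by simpa [mem_ball, dist_eq_norm] using hz
    exact ((hw.contDiffAt (isOpen_ball.mem_nhds hz')).comp z
      (contDiff_id.add contDiff_const).contDiffAt).contDiffWithinAt
  have hdbar : ∀ z, dbarAlong 1 w' z = dbarAlong 1 w (z + c) := fun z => by
    simp only [dbarAlong, hw', fderiv_comp_add_right]
  have hineq' : ∀ z ∈ ball (0 : ℂ) r, ‖dbarAlong 1 w' z‖ ≤ K * ‖w' z‖ := by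
    intro z hz
    rw [hdbar]
    exact hineq (z + c) (by simpa [mem_ball, dist_eq_norm] using hz)
  have key := zeroDichotomy_of_norm_dbar_le_zero hr hw'd hineq'
  -- translate back
  have htr : map (· + c) (𝓝 (0 : ℂ)) = 𝓝 c := by rw [map_add_right_nhds_zero]
  rcases key with h | h
  · left
    rw [← htr, Filter.eventually_map]
    exact h
  · right
    rw [eventually_nhdsWithin_iff] at h ⊢
    rw [← htr, Filter.eventually_map]
    filter_upwards [h] with z hz hzc
    refine hz ?_
    rw [mem_compl_iff, mem_singleton_iff] at hzc ⊢
    intro h0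
    exact hzc (by rw [h0, zero_add])

/-- **Vector-valued similarity principle: the zero dichotomy for maps into a finite-dimensional
complex normed space**, in the normalisation `‖Dv(z) 1 + i • Dv(z) i‖ ≤ K ‖v z‖` of the tree's
named fact `Literature.Geometry.Symplectic.dbarInequality_zeroDichotomy` (for `C^∞` data; that
fact asks only `C¹`). Transfer to a Euclidean space by a continuous linear isomorphism.
[cite: WendlLectures2010, Thm 2.50] -/
theorem zeroDichotomy_of_norm_dbar_le_normedSpace {G : Type*} [NormedAddCommGroup G]
    [NormedSpace ℂ G] [FiniteDimensional ℂ G] {v : ℂ → G} {c : ℂ} {r K : ℝ} (hr : 0 < r)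
    (hv : ContDiffOn ℝ ∞ v (ball c r))
    (hineq : ∀ z ∈ ball c r,
      ‖fderiv ℝ v z 1 + Complex.I • fderiv ℝ v z Complex.I‖ ≤ K * ‖v z‖) :
    (∀ᶠ z in 𝓝 c, v z = 0) ∨ (∀ᶠ z in 𝓝[≠] c, v z ≠ 0) := by
  -- a continuous linear isomorphism onto a Euclidean space
  set d := Module.finrank ℂ G
  have hd : Module.finrank ℂ G = Module.finrank ℂ (EuclideanSpace ℂ (Fin d)) := by
    rw [finrank_euclideanSpace_fin]
  obtain ⟨L, -⟩ : ∃ _L : G ≃L[ℂ] EuclideanSpace ℂ (Fin d), True :=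
    ⟨ContinuousLinearEquiv.ofFinrankEq hd, trivial⟩
  obtain ⟨w, hw⟩ : ∃ w : ℂ → EuclideanSpace ℂ (Fin d), ∀ z, w z = L (v z) := ⟨_, fun _ => rfl⟩
  have hwf : w = fun z => L (v z) := funext hw
  have hLd : ContDiff ℝ ∞ fun x : G => L x :=
    ((L : G →L[ℂ] EuclideanSpace ℂ (Fin d)).contDiff).restrict_scalars ℝ
  have hwd : ContDiffOn ℝ ∞ w (ball c r) := by rw [hwf]; exact hLd.comp_contDiffOn hv
  have hfd : ∀ z ∈ ball c r, ∀ y : ℂ, fderiv ℝ w z y = L (fderiv ℝ v z y) := by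
    intro z hz y
    have hvd : DifferentiableAt ℝ v z :=
      (hv.contDiffAt (isOpen_ball.mem_nhds hz)).differentiableAt (by simp)
    have h1 : HasFDerivAt (fun z => L (v z))
        (((L : G →L[ℂ] EuclideanSpace ℂ (Fin d)).restrictScalars ℝ).comp (fderiv ℝ v z)) z :=
      ((L : G →L[ℂ] EuclideanSpace ℂ (Fin d)).hasFDerivAt.restrictScalars ℝ).comp z hvd.hasFDerivAt
    rw [hwf, h1.fderiv]
    rfl
  set K' : ℝ := 2⁻¹ * ‖(L : G →L[ℂ] EuclideanSpace ℂ (Fin d))‖ * max K 0 *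
    ‖(L.symm : EuclideanSpace ℂ (Fin d) →L[ℂ] G)‖ with hK'
  have hineq' : ∀ z ∈ ball c r, ‖dbarAlong 1 w z‖ ≤ K' * ‖w z‖ := by
    intro z hz
    have e : dbarAlong 1 w z =
        (2 : ℂ)⁻¹ • L (fderiv ℝ v z 1 + Complex.I • fderiv ℝ v z Complex.I) := by
      rw [dbarAlong, smul_eq_mul, mul_one, hfd z hz, hfd z hz, map_add L, map_smul L]
    have hvz : ‖v z‖ ≤ ‖(L.symm : EuclideanSpace ℂ (Fin d) →L[ℂ] G)‖ * ‖w z‖ := by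
      have h2 : v z = L.symm (w z) := by rw [hw, ContinuousLinearEquiv.symm_apply_apply]
      rw [h2]
      exact (L.symm : EuclideanSpace ℂ (Fin d) →L[ℂ] G).le_opNorm _
    have hL1 : ‖L (fderiv ℝ v z 1 + Complex.I • fderiv ℝ v z Complex.I)‖ ≤
        ‖(L : G →L[ℂ] EuclideanSpace ℂ (Fin d))‖ * (max K 0 * ‖v z‖) :=
      ((L : G →L[ℂ] EuclideanSpace ℂ (Fin d)).le_opNorm _).trans (mul_le_mul_of_nonneg_left
        ((hineq z hz).trans (mul_le_mul_of_nonneg_right (le_max_left _ _) (norm_nonneg _)))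
        (norm_nonneg _))
    rw [e, norm_smul, norm_inv, Complex.norm_two]
    calc 2⁻¹ * ‖L (fderiv ℝ v z 1 + Complex.I • fderiv ℝ v z Complex.I)‖
        ≤ 2⁻¹ * (‖(L : G →L[ℂ] EuclideanSpace ℂ (Fin d))‖ * (max K 0 * ‖v z‖)) := by gcongr
      _ ≤ 2⁻¹ * (‖(L : G →L[ℂ] EuclideanSpace ℂ (Fin d))‖ * (max K 0 *
          (‖(L.symm : EuclideanSpace ℂ (Fin d) →L[ℂ] G)‖ * ‖w z‖))) := by gcongr
      _ = K' * ‖w z‖ := by rw [hK']; ring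
  have hiff : ∀ z, w z = 0 ↔ v z = 0 := fun z => by
    rw [hw, map_eq_zero_iff L L.injective]
  rcases zeroDichotomy_of_norm_dbar_le hr hwd hineq' with h | h
  · left
    filter_upwards [h] with z hz using (hiff z).1 hz
  · right
    filter_upwards [h] with z hz using fun h' => hz ((hiff z).2 h')

/-- **Vector-valued similarity principle, comparison form, for maps into a finite-dimensional
complex normed space** (transfer of `exists_holomorphic_comparison_of_norm_dbar_le_zero` through a
continuous linear isomorphism onto a Euclidean space): for `v` smooth on `B(0, r)` with
`‖Dv(z) 1 + i • Dv(z) i‖ ≤ K ‖v z‖` there, on a smaller disc `B(0, ρ₂)` there is a holomorphic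
`H` with `c₁ ‖v z‖ ≤ ‖H z‖ ≤ c₂ ‖v z‖`, `c₁ > 0`. [cite: WendlLectures2010, Thm 2.50] -/
theorem exists_holomorphic_comparison_of_norm_dbar_le_normedSpace {G : Type*}
    [NormedAddCommGroup G] [NormedSpace ℂ G] [FiniteDimensional ℂ G] {v : ℂ → G} {r K : ℝ}
    (hr : 0 < r) (hv : ContDiffOn ℝ ∞ v (ball 0 r))
    (hineq : ∀ z ∈ ball (0 : ℂ) r,
      ‖fderiv ℝ v z 1 + Complex.I • fderiv ℝ v z Complex.I‖ ≤ K * ‖v z‖) :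
    ∃ ρ₂ : ℝ, 0 < ρ₂ ∧ ρ₂ < r ∧ ∃ (c₁ c₂ : ℝ) (H : ℂ → G), 0 < c₁ ∧
      DifferentiableOn ℂ H (ball 0 ρ₂) ∧
      ∀ z ∈ ball (0 : ℂ) ρ₂, c₁ * ‖v z‖ ≤ ‖H z‖ ∧ ‖H z‖ ≤ c₂ * ‖v z‖ := by
  -- a continuous linear isomorphism onto a Euclidean space
  set d := Module.finrank ℂ G
  have hd : Module.finrank ℂ G = Module.finrank ℂ (EuclideanSpace ℂ (Fin d)) := by
    rw [finrank_euclideanSpace_fin]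
  obtain ⟨L, -⟩ : ∃ _L : G ≃L[ℂ] EuclideanSpace ℂ (Fin d), True :=
    ⟨ContinuousLinearEquiv.ofFinrankEq hd, trivial⟩
  obtain ⟨w, hw⟩ : ∃ w : ℂ → EuclideanSpace ℂ (Fin d), ∀ z, w z = L (v z) := ⟨_, fun _ => rfl⟩
  have hwf : w = fun z => L (v z) := funext hw
  have hLd : ContDiff ℝ ∞ fun x : G => L x :=
    ((L : G →L[ℂ] EuclideanSpace ℂ (Fin d)).contDiff).restrict_scalars ℝ
  have hwd : ContDiffOn ℝ ∞ w (ball 0 r) := by rw [hwf]; exact hLd.comp_contDiffOn hv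
  have hfd : ∀ z ∈ ball (0 : ℂ) r, ∀ y : ℂ, fderiv ℝ w z y = L (fderiv ℝ v z y) := by
    intro z hz y
    have hvd : DifferentiableAt ℝ v z :=
      (hv.contDiffAt (isOpen_ball.mem_nhds hz)).differentiableAt (by simp)
    have h1 : HasFDerivAt (fun z => L (v z))
        (((L : G →L[ℂ] EuclideanSpace ℂ (Fin d)).restrictScalars ℝ).comp (fderiv ℝ v z)) z :=
      ((L : G →L[ℂ] EuclideanSpace ℂ (Fin d)).hasFDerivAt.restrictScalars ℝ).comp z hvd.hasFDerivAt
    rw [hwf, h1.fderiv]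
    rfl
  set nL : ℝ := ‖(L : G →L[ℂ] EuclideanSpace ℂ (Fin d))‖ with hnL
  set nLs : ℝ := ‖(L.symm : EuclideanSpace ℂ (Fin d) →L[ℂ] G)‖ with hnLs
  set K' : ℝ := 2⁻¹ * nL * max K 0 * nLs with hK'
  have hK'nn : 0 ≤ K' := by rw [hK']; positivity
  have hvw : ∀ z, ‖v z‖ ≤ nLs * ‖w z‖ := fun z => by
    have h2 : v z = L.symm (w z) := by rw [hw, ContinuousLinearEquiv.symm_apply_apply]
    rw [h2]
    exact (L.symm : EuclideanSpace ℂ (Fin d) →L[ℂ] G).le_opNorm _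
  have hwv : ∀ z, ‖w z‖ ≤ nL * ‖v z‖ := fun z => by
    rw [hw]
    exact (L : G →L[ℂ] EuclideanSpace ℂ (Fin d)).le_opNorm _
  have hineq' : ∀ z ∈ ball (0 : ℂ) r, ‖dbarAlong 1 w z‖ ≤ K' * ‖w z‖ := by
    intro z hz
    have e : dbarAlong 1 w z =
        (2 : ℂ)⁻¹ • L (fderiv ℝ v z 1 + Complex.I • fderiv ℝ v z Complex.I) := by
      rw [dbarAlong, smul_eq_mul, mul_one, hfd z hz, hfd z hz, map_add L, map_smul L]
    have hL1 : ‖L (fderiv ℝ v z 1 + Complex.I • fderiv ℝ v z Complex.I)‖ ≤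
        nL * (max K 0 * ‖v z‖) :=
      ((L : G →L[ℂ] EuclideanSpace ℂ (Fin d)).le_opNorm _).trans (mul_le_mul_of_nonneg_left
        ((hineq z hz).trans (mul_le_mul_of_nonneg_right (le_max_left _ _) (norm_nonneg _)))
        (norm_nonneg _))
    rw [e, norm_smul, norm_inv, Complex.norm_two]
    calc 2⁻¹ * ‖L (fderiv ℝ v z 1 + Complex.I • fderiv ℝ v z Complex.I)‖
        ≤ 2⁻¹ * (nL * (max K 0 * ‖v z‖)) := by gcongr
      _ ≤ 2⁻¹ * (nL * (max K 0 * (nLs * ‖w z‖))) := by gcongr; exact hvw z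
      _ = K' * ‖w z‖ := by rw [hK']; ring
  obtain ⟨ρ₂, hρ₂, hρ₂r, H', hH'd, hH'⟩ :=
    exists_holomorphic_comparison_of_norm_dbar_le_zero hr hK'nn hwd hineq'
  -- transport the comparison function back to `G`
  set M : ℝ := 3 / 2 * nLs * nL with hM
  have hMnn : 0 ≤ M := by rw [hM]; positivity
  refine ⟨ρ₂, hρ₂, hρ₂r, 1 / (M + 1), nLs * (4 / 3) * nL, fun z => L.symm (H' z),
    by positivity, ?_, fun z hz => ⟨?_, ?_⟩⟩
  · exact ((L.symm : EuclideanSpace ℂ (Fin d) →L[ℂ] G).differentiable.comp_differentiableOn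
      hH'd :)
  · -- lower bound: `‖v‖ ≤ M ‖H‖`
    have h1 : ‖v z‖ ≤ M * ‖L.symm (H' z)‖ := by
      have hH'z : H' z = L (L.symm (H' z)) := by rw [ContinuousLinearEquiv.apply_symm_apply]
      calc ‖v z‖ ≤ nLs * ‖w z‖ := hvw z
        _ ≤ nLs * (3 / 2 * ‖H' z‖) := by
            gcongr
            linarith [(hH' z hz).1]
        _ ≤ nLs * (3 / 2 * (nL * ‖L.symm (H' z)‖)) := by
            gcongr
            rw [hH'z, ContinuousLinearEquiv.symm_apply_apply]
            exact (L : G →L[ℂ] EuclideanSpace ℂ (Fin d)).le_opNorm _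
        _ = M * ‖L.symm (H' z)‖ := by rw [hM]; ring
    rw [div_mul_eq_mul_div, one_mul, div_le_iff₀ (by positivity)]
    nlinarith [norm_nonneg (L.symm (H' z)), norm_nonneg (v z)]
  · calc ‖L.symm (H' z)‖ ≤ nLs * ‖H' z‖ :=
          (L.symm : EuclideanSpace ℂ (Fin d) →L[ℂ] G).le_opNorm _
      _ ≤ nLs * (4 / 3 * ‖w z‖) := by gcongr; exact (hH' z hz).2
      _ ≤ nLs * (4 / 3 * (nL * ‖v z‖)) := by gcongr; exact hwv z
      _ = nLs * (4 / 3) * nL * ‖v z‖ := by ring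

end Literature.Analysis.Complex
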